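import Literature.MathematicalPhysics.QuantumManyBody.PeriodicBoseGasBox
import HarnessLib

/-!
# Fournais 2020, §2: the `n`-particle bound (2.43)–(2.46) behind Theorem 2.1

Topic `Literature/MathematicalPhysics/QuantumManyBody`, sibling of `PeriodicBoseGasBox.lean`
(provefact `Literature.MathematicalPhysics.QuantumManyBody.BoseGas.Fournais2020_condensation`). The small-box theorem
[Fournais2020, Thm. 2.1] (`Fournais2020_thm21`, one of the two named facts to which
`Fournais2020_condensation` is reduced, see `PeriodicBoseGasReduction.lean`) is proved in the
paper (pp. 7–13) in two layers:

* the bound on each `n`-particle sector of the box `Λ`,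
  `(H_Λ(ρ_μ))_n ≥ E_Main + E_gap + E_error` [Fournais2020, (2.43)–(2.46)], obtained by adding
  Lemma 2.3 ("[FournaisSolovej2020, Lemma B.2]", the potential-energy decomposition of
  Lemma 2.2 plus Cauchy–Schwarz, in the form (2.25)) and Lemma 2.4 (the second-quantised
  Bogoliubov-type completion of squares (2.27)–(2.42)), in which the pairing term `A₂` (2.24)
  cancels;
* the particle-number bookkeeping: dividing the `M` particles into groups of
  `≈ Ξρ_μℓ³` (2.12)–(2.14), choosing `K` large so that `E_gap ≥ 0` (2.48) and `ρ_μa³` small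
  (2.47), (2.49)–(2.50).

This file vendors the first layer as the named fact `Fournais2020_eq243`, together with the one
object it needs beyond `PeriodicBoseGasBox.lean`: the expectation `⟨Φ, n₊Φ⟩` of the number of
excited particles `n₊ = ∑ᵢ Qᵢ` (2.15) (`nPlusBoxN`). All of Lemmas 2.2–2.4 and (2.43) are
statements on a fixed `n`-particle sector `L²(Λⁿ)` (`Pᵢ, Qᵢ` act on the `i`-th particle,
`n₀ = ∑Pᵢ`, `n₊ = ∑Qᵢ`, `A₂ = ½∑_{i≠j}PᵢPⱼw₁(xᵢ,xⱼ)QⱼQᵢ + h.c.` preserve the particle number,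
and so do the `b_k = ℓ^{-3/2}a₀†a(Qχ_Λe^{-ikx})` of (2.27)), so no Fock space is needed to state
or prove them. The second layer, Thm. 2.1 from (2.43), is left to a proofs file.

## Rendering

* `⟨Φ, n₊Φ⟩ = ∑ᵢ ‖QᵢΦ‖²` with `(QᵢΦ)(X) = Φ(X) - ℓ⁻³∫_Λ Φ(X; xᵢ = y) dy` on `Λⁿ` (2.5), (2.15),
  written slice-wise as `kinBoxN`: `ℓ⁻³ ∫_{Λⁿ} ‖Q Φ(X;·ᵢ)‖² dX` with the one-body `Q = Q_u` of
  (3.5) (`projQ`), the integrand being independent of `xᵢ ∈ Λ` (`nPlusBoxN`). With this,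
  `⟨Φ,TᵢΦ⟩ ≥ bℓ⁻²‖QᵢΦ‖²` termwise (`nPlusBoxN_le_kinBoxN`).
* (2.43) with (2.44) `E_Main = -4πaρ_μ²ℓ³ + 2π(a/ℓ³)(ρ_μℓ³ - n)²`,
  (2.45) `E_gap = (bℓ⁻² - Ca((n+1)/ℓ³ + ρ_μ)) n₊`,
  (2.46) `E_error = -Cnaℓ⁻³(1 + a²(n+1)²/ℓ² + (n+1)R²/ℓ²) - Caρ_μ`,
  as the form inequality on symmetric measurable `Φ` on `Λⁿ`, additively in `ℝ≥0∞` (every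
  coefficient split into its non-negative parts):
  `ρ_μ∑ᵢ⟨∫w₁(xᵢ,y)dy⟩ + 2π(a/ℓ³)(ρ_μℓ³-n)²‖Φ‖² + bℓ⁻²⟨n₊⟩ ≤`
  `∑ᵢ⟨Tᵢ⟩ + ⟨∑_{i<j}w(xᵢ,xⱼ)⟩ + Ca((n+1)/ℓ³ + ρ_μ)⟨n₊⟩ + (4πaρ_μ²ℓ³ + Cnaℓ⁻³(1 + a²(n+1)²/ℓ² + (n+1)R²/ℓ²) + Caρ_μ)‖Φ‖²`.
* Constants, weakest reading: (2.43) holds on the box of side `ℓ` before any relation between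
  `ℓ` and `ρ_μ` is imposed (`K` enters only in (2.47)–(2.48)); its constant comes from Lemma 2.3
  ("there is a constant `C > 0`") and from (2.37), (2.41), (2.42) in the proof of Lemma 2.4
  (the momentum splitting at `|p| ≍ s⁻¹ℓ⁻¹`, bounds on `Ŵ₁` through `χ`, and
  `0 ≤ W₁ ≤ (1 + C(R/ℓ)²)g`, which with the well-definedness of `W` (2.4) requires `R/ℓ`
  small). We therefore let `C` and the smallness `c₁` of `R/ℓ` depend on everything fixed
  before the box (`v, ω, χ, b, s, R`) but not on `ℓ, ρ_μ, n, u, Φ`.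

## References

* [Fournais2020] S. Fournais, *Length scales for BEC in the dilute Bose gas*, arXiv:2011.00309,
  EMS Ser. Congr. Rep. 18 (2021), doi:10.4171/ecr/18-1/7: (2.5), (2.15), Lemmas 2.2–2.4,
  (2.22)–(2.26), (2.43)–(2.50).
* [FournaisSolovej2020] S. Fournais, J. P. Solovej, *The energy of dilute Bose gases*,
  Ann. of Math. 192 (2020) 893–976, arXiv:1904.06164: Lemma B.2.
-/

noncomputable section

open MeasureTheory
open scoped ENNReal NNReal

namespace Literature.MathematicalPhysics.QuantumManyBody.BoseGas

/-! ### The number of excited particles `n₊` (2.15) -/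

/-- `⟨Φ, n₊ Φ⟩ = ∑ᵢ ‖QᵢΦ‖²` for an `M`-body function on the box `Λ(u)`, `n₊ = ∑ᵢ Qᵢ` (2.15)
with `Q = 1 - P`, `P = ℓ⁻³|1⟩⟨1|` (2.5) acting on the `i`-th particle: written, as `kinBoxN`, as
`ℓ⁻³ ∫_{Λ^M} ‖Q Φ(X; ·ᵢ)‖² dX` with the one-body `Q = Q_u` (`projQ`, (3.5)) applied to the slice
`Φ(X; ·ᵢ) = y ↦ Φ(x₁,…,x_{i-1},y,x_{i+1},…)` (the integrand does not depend on `xᵢ ∈ Λ(u)`,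
`|Λ(u)| = ℓ³`). [cite: Fournais2020, (2.15), (2.5)] -/
def nPlusBoxN {M : ℕ} (ℓ : ℝ) (u : Space) (Φ : Config M → ℂ) : ℝ≥0∞ :=
  ∑ i : Fin M, (ENNReal.ofReal ℓ ^ 3)⁻¹ *
    ∫⁻ X in boxConfig M ℓ u, ∫⁻ x, (‖projQ ℓ u (fun y => Φ (Function.update X i y)) x‖₊ : ℝ≥0∞) ^ 2

/-! ### Named fact: the `n`-particle bound (2.43)–(2.46) -/

/-- **Fournais 2020, (2.43)–(2.46)** (the bound on the `n`-particle sector of the box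
Hamiltonian from Lemmas 2.3 and 2.4). Let `v` satisfy Assumption 1.1 with scattering solution
`ω`, scattering length `a` and `supp v ⊂ B(0,R)`, and let the localisation function `χ` and the
constants `b, s > 0` of `T` (2.7) be given. "Using Lemma 2.3 (in the form of (2.25)) and
Lemma 2.4 … combining the terms, remembering that the 'gap' of the kinetic energy was saved, we
find on the `n`-particle subspace `(H_Λ(ρ_μ))_n ≥ E_Main + E_gap + E_error` (2.43), with
`E_Main := (n²/(2ℓ³))8πa - (ρ_μ n/ℓ³ + ¼(ρ_μ - n/ℓ³)²)8πaℓ³ = -4πaρ_μ²ℓ³ + 2π(a/ℓ³)(ρ_μℓ³ - n)²`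
(2.44), `E_gap := (bℓ⁻² - Ca((n+1)/ℓ³ + ρ_μ)) n₊` (2.45), and
`E_error := -Cnaℓ⁻³(1 + a²(n+1)²/ℓ² + (n+1)R²/ℓ²) - Caρ_μ` (2.46)." Here
`(H_Λ(ρ_μ))_n = ∑ᵢ(T^{(i)} - ρ_μ∫w₁(xᵢ,y)dy) + ∑_{i<j}w(xᵢ,xⱼ)` (2.6) and `n₊ = ∑ᵢQᵢ` (2.15).
The constant `C` is that of Lemma 2.3 ([FournaisSolovej2020, Lemma B.2]) and of (2.37), (2.41),
(2.42) (depending on `s`, on `χ`, and requiring `R/ℓ` small for `0 ≤ W₁ ≤ (1 + C(R/ℓ)²)g` and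
the well-definedness of `W`); it is quantified after `v, ω, χ, b, s, R` and before the box
(weakest reading; `K` of (2.1) plays no role before (2.47)). Vendored as the form inequality on
symmetric measurable `Φ` on `Λ(u)ⁿ`, additively in `ℝ≥0∞`.
[cite: Fournais2020, (2.43)–(2.46), Lemma 2.3 (2.22)–(2.25), Lemma 2.4 (2.26)]
[cite: FournaisSolovej2020, Lemma B.2] -/
def Fournais2020_eq243 : Prop :=
  ∀ (v : ℝ → ℝ≥0∞), IsRepulsiveFiniteRange v → (∫⁻ x : Space, v ‖x‖) ≠ ⊤ →
    0 < scatteringLength v →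
  ∀ (ω : Space → ℝ), IsScatteringSolution v ω →
  ∀ (χ : Space → ℝ), IsLocalizationFunction χ →
  ∀ (b s : ℝ), 0 < b → 0 < s →
  ∀ (R : ℝ), 0 < R → (∀ r, R < r → v r = 0) →
  ∃ C c₁ : ℝ, 0 < C ∧ 0 < c₁ ∧
    ∀ (ℓ ρμ : ℝ), 0 < ℓ → 0 < ρμ → R ≤ c₁ * ℓ →
      let a := (scatteringLength v).toReal
      ∀ (n : ℕ) (u : Space) (Φ : Config n → ℂ), Measurable Φ →
        (∀ (σ : Equiv.Perm (Fin n)) (X : Config n), Φ (X ∘ σ) = Φ X) →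
        (∫⁻ X in boxConfig n ℓ u, attrBoxN v ω χ ℓ ρμ u X * (‖Φ X‖₊ : ℝ≥0∞) ^ 2) +
            ENNReal.ofReal (2 * Real.pi * (a / ℓ ^ 3) * (ρμ * ℓ ^ 3 - n) ^ 2) *
              (∫⁻ X in boxConfig n ℓ u, (‖Φ X‖₊ : ℝ≥0∞) ^ 2) +
            ENNReal.ofReal (b / ℓ ^ 2) * nPlusBoxN ℓ u Φ ≤
          kinBoxN χ ℓ s b u Φ +
            (∫⁻ X in boxConfig n ℓ u, repBoxN v χ ℓ u X * (‖Φ X‖₊ : ℝ≥0∞) ^ 2) +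
            ENNReal.ofReal (C * a * ((n + 1) / ℓ ^ 3 + ρμ)) * nPlusBoxN ℓ u Φ +
            ENNReal.ofReal (4 * Real.pi * a * ρμ ^ 2 * ℓ ^ 3 +
                C * n * a / ℓ ^ 3 * (1 + a ^ 2 * (n + 1) ^ 2 / ℓ ^ 2 + (n + 1) * R ^ 2 / ℓ ^ 2) +
                C * a * ρμ) *
              ∫⁻ X in boxConfig n ℓ u, (‖Φ X‖₊ : ℝ≥0∞) ^ 2

/-! ### Basic API -/

/-- With no particles, `⟨Φ, n₊Φ⟩ = 0`. [cite: Fournais2020, (2.15)] -/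
theorem nPlusBoxN_zero (ℓ : ℝ) (u : Space) (Φ : Config 0 → ℂ) : nPlusBoxN ℓ u Φ = 0 := by
  simp [nPlusBoxN]

/-- **The gap term of `T` controls `n₊`**: `bℓ⁻² ⟨Φ, n₊Φ⟩ ≤ ∑ᵢ ⟨Φ, T^{(i)}Φ⟩`, termwise from
`T = Q(χ_Λ[-Δ - s⁻²ℓ⁻²]₊χ_Λ + bℓ⁻²)Q ≥ bℓ⁻²Q` (2.7) ("remembering that the 'gap' of the
kinetic energy was saved", (2.43), (2.45)). [cite: Fournais2020, (2.7), (2.45)] -/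
theorem nPlusBoxN_le_kinBoxN {M : ℕ} (χ : Space → ℝ) (ℓ s b : ℝ) (u : Space)
    (Φ : Config M → ℂ) :
    ENNReal.ofReal (b / ℓ ^ 2) * nPlusBoxN ℓ u Φ ≤ kinBoxN χ ℓ s b u Φ := by
  unfold nPlusBoxN kinBoxN
  rw [Finset.mul_sum]
  refine Finset.sum_le_sum fun i _ => ?_
  rw [← mul_assoc, mul_comm (ENNReal.ofReal (b / ℓ ^ 2)), mul_assoc]
  refine mul_le_mul_right ?_ _
  rw [← lintegral_const_mul' _ _ ENNReal.ofReal_ne_top]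
  refine lintegral_mono fun X => ?_
  unfold kinLoc
  exact le_add_self

end Literature.MathematicalPhysics.QuantumManyBody.BoseGas

end
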